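import Mathlib
import Summits.Ventures.PercRepro2.Defs
import Summits.Ventures.PercRepro2.Independence
import Summits.Ventures.PercRepro2.Harris
import Summits.Ventures.PercRepro2.Graph
import Summits.Ventures.PercRepro2.Exploration
import Summits.Ventures.PercRepro2.Events
import Summits.Ventures.PercRepro2.Induced
import Summits.Ventures.PercRepro2.BHKEvents
import Summits.Ventures.PercRepro2.R4Defs
import Summits.Ventures.PercRepro2.R4Ladder
import Summits.Ventures.PercRepro2.StarRoot
import Summits.Ventures.PercRepro2.StarCells

/-!
# Star-attached roots: probabilities of the cells (blind cell PercRepro2, p1)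

Independence of the hit events (disjoint edge sets at `o`) from each other and from the
`ω'`-states gives the closed forms of LEAD-PROOFSHAPES §8.7 (9): with `α, β, γ` the hit
probabilities and `P₀, P₁, P₂` the state probabilities,
`x₀₀ = (1−α)(P₀+P₂)`, `x₀₁ = (1−α)(1−β)P₁`, `x₁₀ = α(1−β)(1−γ)(P₀+P₂)`,
`x₁₁ = (1−γ)[P₁(α+β−αβ) + P₀αβ]`.
-/

namespace Summit.Ventures.PercRepro2

section StarIndependence

variable {V : Type*} {E : Type*} [Fintype E] [DecidableEq E] [DecidableEq V]
  {R : Type*} [CommRing R]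

/-- The edge set of the hit event `hitEdge ends o x`. -/
def hitEdges (ends : E → Sym2 V) (o x : V) : Set E := {e | ends e = s(o, x)}

omit [Fintype E] [DecidableEq E] [DecidableEq V] in
/-- `hitEdge ends o x` is determined by its edge set. -/
lemma dependsOn_hitEdge (ends : E → Sym2 V) (o x : V) :
    DependsOn (· ∈ hitEdge ends o x) (hitEdges ends o x) := by
  intro ω ω' h
  show (∃ e, ω e = true ∧ ends e = s(o, x)) = ∃ e, ω' e = true ∧ ends e = s(o, x)
  refine propext ⟨?_, ?_⟩
  · rintro ⟨e, he, hends⟩; exact ⟨e, by rw [← h e hends]; exact he, hends⟩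
  · rintro ⟨e, he, hends⟩; exact ⟨e, by rw [h e hends]; exact he, hends⟩

omit [Fintype E] [DecidableEq E] [DecidableEq V] in
/-- Hit edge sets of distinct targets (`≠ o`) are disjoint. -/
lemma disjoint_hitEdges (ends : E → Sym2 V) {o x y : V} (hxy : x ≠ y) (hx : x ≠ o) :
    Disjoint (hitEdges ends o x) (hitEdges ends o y) := by
  rw [Set.disjoint_left]
  intro e hex hey
  simp only [hitEdges, Set.mem_setOf_eq] at hex hey
  rw [hex, Sym2.eq_iff] at hey
  rcases hey with ⟨_, h⟩ | ⟨_, h⟩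
  · exact hxy h
  · exact hx h

omit [Fintype E] [DecidableEq E] [DecidableEq V] in
/-- Hit edge sets lie in the edges touching `o`. -/
lemma hitEdges_subset_touches (ends : E → Sym2 V) (o x : V) :
    hitEdges ends o x ⊆ touches ends ({o} : Set V) :=
  fun _ he => ⟨o, Set.mem_singleton o, x, he⟩

omit [Fintype E] [DecidableEq E] [DecidableEq V] in
/-- Hit edge sets are disjoint from the edges not touching `o`. -/
lemma disjoint_hitEdges_compl (ends : E → Sym2 V) (o x : V) :
    Disjoint (hitEdges ends o x) (touches ends ({o} : Set V))ᶜ :=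
  Set.disjoint_compl_right_iff_subset.2 (hitEdges_subset_touches ends o x)

omit [Fintype E] [DecidableEq E] [DecidableEq V] in
/-- Any event defined through `delConfig ends {o}` is determined by the edges not touching `o`. -/
lemma dependsOn_delConfig_event (ends : E → Sym2 V) (o : V) (P : Config E → Prop) :
    DependsOn (· ∈ {ω | P (delConfig ends {o} ω)}) (touches ends ({o} : Set V))ᶜ := by
  intro ω ω' h
  show P (delConfig ends {o} ω) = P (delConfig ends {o} ω')
  rw [delConfig_congr h]

omit [Fintype E] [DecidableEq E] [DecidableEq V] in
/-- `stateNone` is determined by the edges not touching `o`. -/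
lemma dependsOn_stateNone (ends : E → Sym2 V) (o a₁ a₂ b : V) :
    DependsOn (· ∈ stateNone ends o a₁ a₂ b) (touches ends ({o} : Set V))ᶜ :=
  dependsOn_delConfig_event ends o fun ω' => ¬ Conn ends ω' a₂ a₁ ∧ ¬ Conn ends ω' a₂ b ∧
    ¬ Conn ends ω' a₁ b

omit [Fintype E] [DecidableEq E] [DecidableEq V] in
/-- `stateTwoB` is determined by the edges not touching `o`. -/
lemma dependsOn_stateTwoB (ends : E → Sym2 V) (o a₁ a₂ b : V) :
    DependsOn (· ∈ stateTwoB ends o a₁ a₂ b) (touches ends ({o} : Set V))ᶜ :=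
  dependsOn_delConfig_event ends o fun ω' => Conn ends ω' a₂ b ∧ ¬ Conn ends ω' a₁ b

omit [Fintype E] [DecidableEq E] [DecidableEq V] in
/-- `stateOneB` is determined by the edges not touching `o`. -/
lemma dependsOn_stateOneB (ends : E → Sym2 V) (o a₁ a₂ b : V) :
    DependsOn (· ∈ stateOneB ends o a₁ a₂ b) (touches ends ({o} : Set V))ᶜ :=
  dependsOn_delConfig_event ends o fun ω' => Conn ends ω' a₁ b ∧ ¬ Conn ends ω' a₂ b

omit [Fintype E] [DecidableEq E] [DecidableEq V] in
/-- `S₀` and `S₂` are disjoint. -/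
lemma disjoint_stateNone_stateOneB (ends : E → Sym2 V) (o a₁ a₂ b : V) :
    Disjoint (stateNone ends o a₁ a₂ b) (stateOneB ends o a₁ a₂ b) := by
  rw [Set.disjoint_left]
  rintro ω ⟨_, _, h⟩ ⟨h', _⟩
  exact h h'

omit [Fintype E] [DecidableEq E] [DecidableEq V] in
/-- `S₁` and `S₀` are disjoint. -/
lemma disjoint_stateTwoB_stateNone (ends : E → Sym2 V) (o a₁ a₂ b : V) :
    Disjoint (stateTwoB ends o a₁ a₂ b) (stateNone ends o a₁ a₂ b) := by
  rw [Set.disjoint_left]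
  rintro ω ⟨h, _⟩ ⟨_, h', _⟩
  exact h' h

omit [DecidableEq V] in
/-- An event determined by edges touching `o` is independent of an event determined by the
other edges. -/
lemma prob_inter_eq_mul_touches (p : E → R) (ends : E → Sym2 V) (o : V) {A B : Set (Config E)}
    (hA : DependsOn (· ∈ A) (touches ends ({o} : Set V)))
    (hB : DependsOn (· ∈ B) (touches ends ({o} : Set V))ᶜ) :
    prob p (A ∩ B) = prob p A * prob p B :=
  prob_inter_eq_mul_of_dependsOn p disjoint_compl_right hA hB

end StarIndependence

/-! ## The probabilities of the four cells -/

section StarCellProbs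

variable {V : Type*} {E : Type*} [Fintype E] [DecidableEq E] [DecidableEq V]
  {R : Type*} [CommRing R]

omit [Fintype E] [DecidableEq E] [DecidableEq V] in
/-- Unions of two events determined by the same edge set are determined by it. -/
lemma dependsOn_union_same {A B : Set (Config E)} {F : Set E} (hA : DependsOn (· ∈ A) F)
    (hB : DependsOn (· ∈ B) F) : DependsOn (· ∈ A ∪ B) F := by
  have := dependsOn_union hA hB
  rwa [Set.union_self] at this

omit [Fintype E] [DecidableEq E] [DecidableEq V] in
/-- The hit event of `x` and its complement are determined by the edges touching `o`. -/
lemma dependsOn_hitEdge_touches (ends : E → Sym2 V) (o x : V) :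
    DependsOn (· ∈ hitEdge ends o x) (touches ends ({o} : Set V)) :=
  DependsOn.mono (hitEdges_subset_touches ends o x) (dependsOn_hitEdge ends o x)

omit [Fintype E] [DecidableEq E] [DecidableEq V] in
/-- `S₀ ∪ S₂` is determined by the edges not touching `o`. -/
lemma dependsOn_stateNone_union_stateOneB (ends : E → Sym2 V) (o a₁ a₂ b : V) :
    DependsOn (· ∈ stateNone ends o a₁ a₂ b ∪ stateOneB ends o a₁ a₂ b)
      (touches ends ({o} : Set V))ᶜ :=
  dependsOn_union_same (dependsOn_stateNone ends o a₁ a₂ b) (dependsOn_stateOneB ends o a₁ a₂ b)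

omit [DecidableEq V] in
/-- Two hit events of distinct targets are independent. -/
lemma prob_hitEdge_inter (p : E → R) (ends : E → Sym2 V) {o x y : V} (hxy : x ≠ y) (hx : x ≠ o)
    (A B : Set (Config E)) (hA : DependsOn (· ∈ A) (hitEdges ends o x))
    (hB : DependsOn (· ∈ B) (hitEdges ends o y)) : prob p (A ∩ B) = prob p A * prob p B :=
  prob_inter_eq_mul_of_dependsOn p (disjoint_hitEdges ends hxy hx) hA hB

/-- `x₀₀ = (1 − α)(P₀ + P₂)`. -/
theorem prob_cell00 (p : E → R) (ends : E → Sym2 V) {o a₁ a₂ b : V}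
    (hS : StarAttached ends o {a₁, a₂, b}) (ho : o ∉ ({a₁, a₂, b} : Finset V)) :
    prob p ((connEvent ends o a₂)ᶜ ∩ avoidAll ends a₂ {a₁, b}) =
      (1 - prob p (hitEdge ends o a₂)) *
        (prob p (stateNone ends o a₁ a₂ b) + prob p (stateOneB ends o a₁ a₂ b)) := by
  rw [cell00_eq hS ho, prob_inter_eq_mul_touches p ends o
    (dependsOn_compl (dependsOn_hitEdge_touches ends o a₂))
    (dependsOn_stateNone_union_stateOneB ends o a₁ a₂ b), prob_compl,
    prob_union_of_disjoint p (disjoint_stateNone_stateOneB ends o a₁ a₂ b)]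

/-- `x₀₁ = (1 − α)(1 − β) P₁`. -/
theorem prob_cell01 (p : E → R) (ends : E → Sym2 V) {o a₁ a₂ b : V}
    (hS : StarAttached ends o {a₁, a₂, b}) (ho : o ∉ ({a₁, a₂, b} : Finset V)) (hab : a₂ ≠ b) :
    prob p ((connEvent ends o a₂)ᶜ ∩ connEvent ends a₂ b ∩ (connEvent ends a₂ a₁)ᶜ) =
      (1 - prob p (hitEdge ends o a₂)) * (1 - prob p (hitEdge ends o b)) *
        prob p (stateTwoB ends o a₁ a₂ b) := by
  have ha₂ : a₂ ≠ o := fun h => ho (h ▸ Finset.mem_insert_of_mem (Finset.mem_insert_self _ _))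
  rw [cell01_eq hS ho, prob_inter_eq_mul_touches p ends o
    (dependsOn_inter_same (dependsOn_compl (dependsOn_hitEdge_touches ends o a₂))
      (dependsOn_compl (dependsOn_hitEdge_touches ends o b)))
    (dependsOn_stateTwoB ends o a₁ a₂ b),
    prob_hitEdge_inter p ends hab ha₂ _ _ (dependsOn_compl (dependsOn_hitEdge ends o a₂))
      (dependsOn_compl (dependsOn_hitEdge ends o b)), prob_compl, prob_compl]

/-- `x₁₀ = α(1 − β)(1 − γ)(P₀ + P₂)`. -/
theorem prob_cell10 (p : E → R) (ends : E → Sym2 V) {o a₁ a₂ b : V}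
    (hS : StarAttached ends o {a₁, a₂, b}) (ho : o ∉ ({a₁, a₂, b} : Finset V)) (hab : a₂ ≠ b)
    (h12 : a₁ ≠ a₂) (h1b : a₁ ≠ b) :
    prob p (connEvent ends o a₂ ∩ avoidAll ends a₂ {a₁, b}) =
      prob p (hitEdge ends o a₂) * (1 - prob p (hitEdge ends o b)) *
        (1 - prob p (hitEdge ends o a₁)) *
        (prob p (stateNone ends o a₁ a₂ b) + prob p (stateOneB ends o a₁ a₂ b)) := by
  have ha₂ : a₂ ≠ o := fun h => ho (h ▸ Finset.mem_insert_of_mem (Finset.mem_insert_self _ _))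
  have ha₁ : a₁ ≠ o := fun h => ho (h ▸ Finset.mem_insert_self _ _)
  rw [cell10_eq hS ho, prob_inter_eq_mul_touches p ends o
    (dependsOn_inter_same (dependsOn_inter_same (dependsOn_hitEdge_touches ends o a₂)
      (dependsOn_compl (dependsOn_hitEdge_touches ends o b)))
      (dependsOn_compl (dependsOn_hitEdge_touches ends o a₁)))
    (dependsOn_stateNone_union_stateOneB ends o a₁ a₂ b),
    prob_union_of_disjoint p (disjoint_stateNone_stateOneB ends o a₁ a₂ b)]
  -- `P(A ∩ Bᶜ ∩ Γᶜ) = P(A ∩ Bᶜ) · P(Γᶜ)` then `P(A ∩ Bᶜ) = P(A) P(Bᶜ)`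
  have h1 : prob p (hitEdge ends o a₂ ∩ (hitEdge ends o b)ᶜ ∩ (hitEdge ends o a₁)ᶜ) =
      prob p (hitEdge ends o a₂ ∩ (hitEdge ends o b)ᶜ) * prob p (hitEdge ends o a₁)ᶜ := by
    refine prob_inter_eq_mul_of_dependsOn p (F₁ := hitEdges ends o a₂ ∪ hitEdges ends o b)
      (F₂ := hitEdges ends o a₁) ?_ (dependsOn_inter (dependsOn_hitEdge ends o a₂)
        (dependsOn_compl (dependsOn_hitEdge ends o b)))
      (dependsOn_compl (dependsOn_hitEdge ends o a₁))
    rw [Set.disjoint_union_left]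
    exact ⟨disjoint_hitEdges ends h12.symm ha₂, disjoint_hitEdges ends h1b.symm
      (fun h => ho (h ▸ Finset.mem_insert_of_mem (Finset.mem_insert_of_mem
        (Finset.mem_singleton_self _))))⟩
  rw [h1, prob_hitEdge_inter p ends hab ha₂ _ _ (dependsOn_hitEdge ends o a₂)
    (dependsOn_compl (dependsOn_hitEdge ends o b)), prob_compl, prob_compl]

/-- `x₁₁ = (1 − γ)[P₁(α + β − αβ) + P₀αβ]`. -/
theorem prob_cell11 (p : E → R) (ends : E → Sym2 V) {o a₁ a₂ b : V}
    (hS : StarAttached ends o {a₁, a₂, b}) (ho : o ∉ ({a₁, a₂, b} : Finset V)) (hab : a₂ ≠ b)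
    (h12 : a₁ ≠ a₂) (h1b : a₁ ≠ b) :
    prob p (connEvent ends o a₂ ∩ connEvent ends a₂ b ∩ (connEvent ends a₂ a₁)ᶜ) =
      (1 - prob p (hitEdge ends o a₁)) *
        (prob p (stateTwoB ends o a₁ a₂ b) *
          (prob p (hitEdge ends o a₂) + prob p (hitEdge ends o b) -
            prob p (hitEdge ends o a₂) * prob p (hitEdge ends o b)) +
         prob p (stateNone ends o a₁ a₂ b) * (prob p (hitEdge ends o a₂) * prob p (hitEdge ends o b))) := by
  have ha₂ : a₂ ≠ o := fun h => ho (h ▸ Finset.mem_insert_of_mem (Finset.mem_insert_self _ _))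
  have hb : b ≠ o := fun h => ho (h ▸ Finset.mem_insert_of_mem (Finset.mem_insert_of_mem
    (Finset.mem_singleton_self _)))
  rw [cell11_eq hS ho]
  -- split off `Γᶜ` (edges `o–a₁`) from the rest (edges `o–a₂`, `o–b`, and the others)
  have hrest : DependsOn (· ∈ (stateTwoB ends o a₁ a₂ b ∩ (hitEdge ends o a₂ ∪ hitEdge ends o b)) ∪
      (stateNone ends o a₁ a₂ b ∩ hitEdge ends o a₂ ∩ hitEdge ends o b))
      ((touches ends ({o} : Set V))ᶜ ∪ (hitEdges ends o a₂ ∪ hitEdges ends o b)) := by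
    refine dependsOn_union_same ?_ ?_
    · exact dependsOn_inter (dependsOn_stateTwoB ends o a₁ a₂ b)
        (dependsOn_union (dependsOn_hitEdge ends o a₂) (dependsOn_hitEdge ends o b))
    · have := dependsOn_inter (dependsOn_inter (dependsOn_stateNone ends o a₁ a₂ b)
        (dependsOn_hitEdge ends o a₂)) (dependsOn_hitEdge ends o b)
      rwa [Set.union_assoc] at this
  have hdisj : Disjoint (hitEdges ends o a₁)
      ((touches ends ({o} : Set V))ᶜ ∪ (hitEdges ends o a₂ ∪ hitEdges ends o b)) := by
    rw [Set.disjoint_union_right, Set.disjoint_union_right]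
    exact ⟨disjoint_hitEdges_compl ends o a₁, disjoint_hitEdges ends h12
      (fun h => ho (h ▸ Finset.mem_insert_self _ _)),
      disjoint_hitEdges ends h1b (fun h => ho (h ▸ Finset.mem_insert_self _ _))⟩
  rw [prob_inter_eq_mul_of_dependsOn p hdisj (dependsOn_compl (dependsOn_hitEdge ends o a₁)) hrest,
    prob_compl]
  congr 1
  -- the two pieces are disjoint (`S₁` vs `S₀`)
  rw [prob_union_of_disjoint p (by
    rw [Set.disjoint_left]
    rintro ω ⟨h1, _⟩ ⟨⟨h0, _⟩, _⟩
    exact Set.disjoint_left.1 (disjoint_stateTwoB_stateNone ends o a₁ a₂ b) h1 h0)]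
  -- `P(S₁ ∩ (A ∪ B)) = P(S₁) · P(A ∪ B)` and `P(A ∪ B) = α + β − αβ`
  have e1 : prob p (stateTwoB ends o a₁ a₂ b ∩ (hitEdge ends o a₂ ∪ hitEdge ends o b)) =
      prob p (stateTwoB ends o a₁ a₂ b) * prob p (hitEdge ends o a₂ ∪ hitEdge ends o b) := by
    rw [Set.inter_comm, prob_inter_eq_mul_touches p ends o
      (dependsOn_union (dependsOn_hitEdge_touches ends o a₂) (dependsOn_hitEdge_touches ends o b)
        |>.mono (by rw [Set.union_self]))
      (dependsOn_stateTwoB ends o a₁ a₂ b), mul_comm]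
  have e2 : prob p (hitEdge ends o a₂ ∪ hitEdge ends o b) =
      prob p (hitEdge ends o a₂) + prob p (hitEdge ends o b) -
        prob p (hitEdge ends o a₂) * prob p (hitEdge ends o b) := by
    have := prob_union_add_prob_inter p (hitEdge ends o a₂) (hitEdge ends o b)
    rw [prob_hitEdge_inter p ends hab ha₂ _ _ (dependsOn_hitEdge ends o a₂)
      (dependsOn_hitEdge ends o b)] at this
    linear_combination this
  -- `P(S₀ ∩ A ∩ B) = P(S₀) · α β`
  have e3 : prob p (stateNone ends o a₁ a₂ b ∩ hitEdge ends o a₂ ∩ hitEdge ends o b) =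
      prob p (stateNone ends o a₁ a₂ b) * (prob p (hitEdge ends o a₂) * prob p (hitEdge ends o b)) := by
    rw [Set.inter_assoc, Set.inter_comm, prob_inter_eq_mul_touches p ends o
      (dependsOn_inter_same (dependsOn_hitEdge_touches ends o a₂) (dependsOn_hitEdge_touches ends o b))
      (dependsOn_stateNone ends o a₁ a₂ b), mul_comm,
      prob_hitEdge_inter p ends hab ha₂ _ _ (dependsOn_hitEdge ends o a₂) (dependsOn_hitEdge ends o b)]
  rw [e1, e2, e3]

end StarCellProbs

end Summit.Ventures.PercRepro2
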